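import Mathlib
import Literature.NumberTheory.Sieve.SingularSeries
import HarnessLib

/-!
# Goldston–Yıldırım, *Higher correlations of divisor sums related to primes I*, Lemma 2.1

Named facts (D-0014: `def … : Prop`, nothing is proved here) recording Lemma 2.1 (p. 13) of
D. A. Goldston and C. Y. Yıldırım, *Higher correlations of divisor sums related to primes I:
triple correlations*, Integers 3 (2003) A5 = arXiv:math/0111212, in its two classical cases
`j = 0` (weights `μ(d)/d`, main term `𝔖₁(k) = ∏_{p ∣ k} p/(p-1) = k/φ(k)`, eq. (2.8)) and
`j = 1` (weights `μ(d)/φ(d)`, main term `𝔖₂(k)` = the Hardy–Littlewood pair singular series,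
eq. (2.9): `2 C₂ ∏_{p ∣ k, p > 2} (p-1)/(p-2)` for even `k`, `0` for odd `k`):

* (2.11) `∑_{d ≤ R, (d,k)=1} μ(d)/φ_j(d) · log(R/d) = 𝔖_{j+1}(k) + r_j(R,k)` with
  (2.12) `r_j(R,k) ≪_j exp(-c₁ √(log R))`;
* (2.13) `∑_{d ≤ R, (d,k)=1} μ(d)/φ_j(d) ≪_j exp(-c₁ √(log R))`;

both "for `R ≥ 1`, `j ≥ 0`, `p(j) ∣ k`, and `0 ≤ log |k| ≪ log R`" (`p(0) = p(1) = 1`, so the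
divisibility condition is void in the two cases recorded). These are the truncated
singular-series evaluations met whenever a von Mangoldt factor is opened as `Λ = μ ⋆ log` and
the Möbius variable is truncated at `d ≤ R` (Selberg; Graham; Goldston–Yıldırım; the `𝔖 + 𝔖 − 𝔖`
main-term bookkeeping of opened prime-pair sums). The untwisted sums (`k = 1`, no coprimality
condition) are PROVED in the tree: `Literature.NumberTheory.LFunctions.abs_sum_moebius_div_le_exp_neg_sqrt_log`
(`∑ μ(d)/d ≪ e^{-c√log x}`) and `…abs_sum_moebius_mul_log_div_add_one_le` (`∑ μ(d) log d/d = -1 + O(e^{-c√log x})`).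

Design choices. (1) The side condition "`0 ≤ log|k| ≪ log R`" (`k` is at most a fixed power of
`R`) is made explicit as `k ≤ R^B` for an arbitrary exponent `B > 0`; as printed, the exponent
`c₁ > 0` in `exp(-c₁ √(log R))` is an ABSOLUTE constant ("c₁ is an absolute positive constant",
p. 13) while the implied constant `C` may depend on `B` (and on `j`, here fixed): the quantifier
order is `∃ c > 0, ∀ B > 0, ∃ C, …` in all four facts. (2) `k ≥ 1` is a natural number (GY allow `k ∈ ℤ ∖ {0}`;
every quantity depends on `|k|` only). (3) `φ_j` (defined by GY on squarefree `d` only) is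
extended to all `d` by `d` resp. `Nat.totient d`; harmless because `μ(d) = 0` off the squarefree
integers. (4) `𝔖₂(k)` is written with the tree's `Literature.NumberTheory.Sieve.singularSeries {0, k}`
(`∏_p (1 - ν_{{0,k}}(p)/p)(1 - 1/p)^{-2}`), which is the same Euler product as GY's (2.5)–(2.7),
(2.9) at `j = 2`. What is NOT here: the cases `j ≥ 2` (generalised totients `φ_j`, singular
series `𝔖_j`, the condition `p(j) ∣ k`), the variant (2.14) without the size condition on `k`,
Lemmas 2.2–2.5 and the correlation Theorems 1.1–1.7 of the paper.
-/

namespace Literature.NumberTheory.Sieve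

/-- **Goldston–Yıldırım I, Lemma 2.1, (2.11)–(2.12) at `j = 0`.** There is an absolute `c > 0`
such that for every exponent `B > 0` there is `C` with, for all integers `k ≥ 1` and reals `R ≥ 1` with `k ≤ R^B`:
`|∑_{d ≤ R, (d,k)=1} μ(d)/d · log(R/d) - k/φ(k)| ≤ C · exp(-c √(log R))`
(main term `𝔖₁(k) = ∏_{p ∣ k} p/(p-1) = k/φ(k)`, eq. (2.8)).
[cite: GoldstonYildirim2001, Lemma 2.1 (2.11) with j = 0] -/
def goldstonYildirim_lemma21_log_j0 : Prop :=
  ∃ c : ℝ, 0 < c ∧ ∀ B : ℝ, 0 < B → ∃ C : ℝ, ∀ k : ℕ, 1 ≤ k → ∀ R : ℝ, 1 ≤ R → (k : ℝ) ≤ R ^ B →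
    |(∑ d ∈ (Finset.Icc 1 ⌊R⌋₊).filter (fun d => Nat.Coprime d k),
        ((ArithmeticFunction.moebius d : ℤ) : ℝ) / (d : ℝ) * Real.log (R / d)) -
        (k : ℝ) / (Nat.totient k : ℝ)| ≤ C * Real.exp (-c * Real.sqrt (Real.log R))

/-- **Goldston–Yıldırım I, Lemma 2.1, (2.13) at `j = 0`.** There is an absolute `c > 0` such that
for every exponent `B > 0` there is `C` with, for all `k ≥ 1`, `R ≥ 1` with `k ≤ R^B`:
`|∑_{d ≤ R, (d,k)=1} μ(d)/d| ≤ C · exp(-c √(log R))`.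
[cite: GoldstonYildirim2001, Lemma 2.1 (2.13) with j = 0] -/
def goldstonYildirim_lemma21_j0 : Prop :=
  ∃ c : ℝ, 0 < c ∧ ∀ B : ℝ, 0 < B → ∃ C : ℝ, ∀ k : ℕ, 1 ≤ k → ∀ R : ℝ, 1 ≤ R → (k : ℝ) ≤ R ^ B →
    |∑ d ∈ (Finset.Icc 1 ⌊R⌋₊).filter (fun d => Nat.Coprime d k),
        ((ArithmeticFunction.moebius d : ℤ) : ℝ) / (d : ℝ)| ≤ C * Real.exp (-c * Real.sqrt (Real.log R))

/-- **Goldston–Yıldırım I, Lemma 2.1, (2.11)–(2.12) at `j = 1`.** There is an absolute `c > 0`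
such that for every exponent `B > 0` there is `C` with, for all `k ≥ 1`, `R ≥ 1` with `k ≤ R^B`:
`|∑_{d ≤ R, (d,k)=1} μ(d)/φ(d) · log(R/d) - 𝔖({0,k})| ≤ C · exp(-c √(log R))`, where
`𝔖({0,k}) = 𝔖₂(k)` is the Hardy–Littlewood pair singular series (eq. (2.9); `0` for odd `k`).
[cite: GoldstonYildirim2001, Lemma 2.1 (2.11) with j = 1] -/
def goldstonYildirim_lemma21_log_j1 : Prop :=
  ∃ c : ℝ, 0 < c ∧ ∀ B : ℝ, 0 < B → ∃ C : ℝ, ∀ k : ℕ, 1 ≤ k → ∀ R : ℝ, 1 ≤ R → (k : ℝ) ≤ R ^ B →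
    |(∑ d ∈ (Finset.Icc 1 ⌊R⌋₊).filter (fun d => Nat.Coprime d k),
        ((ArithmeticFunction.moebius d : ℤ) : ℝ) / (Nat.totient d : ℝ) * Real.log (R / d)) -
        singularSeries ({0, (k : ℤ)} : Finset ℤ)| ≤ C * Real.exp (-c * Real.sqrt (Real.log R))

/-- **Goldston–Yıldırım I, Lemma 2.1, (2.13) at `j = 1`.** There is an absolute `c > 0` such that
for every exponent `B > 0` there is `C` with, for all `k ≥ 1`, `R ≥ 1` with `k ≤ R^B`:
`|∑_{d ≤ R, (d,k)=1} μ(d)/φ(d)| ≤ C · exp(-c √(log R))`.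
[cite: GoldstonYildirim2001, Lemma 2.1 (2.13) with j = 1] -/
def goldstonYildirim_lemma21_j1 : Prop :=
  ∃ c : ℝ, 0 < c ∧ ∀ B : ℝ, 0 < B → ∃ C : ℝ, ∀ k : ℕ, 1 ≤ k → ∀ R : ℝ, 1 ≤ R → (k : ℝ) ≤ R ^ B →
    |∑ d ∈ (Finset.Icc 1 ⌊R⌋₊).filter (fun d => Nat.Coprime d k),
        ((ArithmeticFunction.moebius d : ℤ) : ℝ) / (Nat.totient d : ℝ)| ≤
      C * Real.exp (-c * Real.sqrt (Real.log R))

end Literature.NumberTheory.Sieve
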